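import Summits.BirchSwinnertonDyer.Rank1Residual.X11b.RouteR1BDPValue
import Summits.BirchSwinnertonDyer.Rank1Residual.X11b.BDPRouteLocalIndex
import Summits.BirchSwinnertonDyer.Rank1Residual.Additive.PadicLogFormalGroup
import HarnessLib

/-!
# X11b, route R1 (every `p`) — the receptacle's `log_{ω_E} P` IS the cell's `p`-adic logarithm of
# `P_ι`: it vanishes exactly at torsion points, and its square does not see the Galois conjugate
# `τ_* P` in rank one

HONEST FRAMING (cell `b2b-bsdres`, run/shared/lean/b2b/bsd-rank1-residual/, verbatim in every
file): the goal of the cell is to DELETE the COMBINATION-SHAPED residual classes of the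
Birch–Swinnerton-Dyer formula for ALL analytic-rank `≤ 1` elliptic curves over `ℚ` — "full BSD
formula for every rank `≤ 1` curve in class `C`" assembled STRICTLY from published theorems — so
that the rank-`≤ 1` remainder becomes exactly the CONSTRUCTION-SHAPED classes, which are TYPED
(missing-input `Prop`s), NOT attempted. This is not "finishing BSD". Sub-cell
`b2b-bsdres-multr1-p1` (X11b, route R1, gen 26); a RESEARCH ROUTE; no claim beyond the stated
class; X11b stays CONSTRUCTION-SHAPED; nothing here changes a label; THEOREMS ONLY (unconditional
bookkeeping about the receptacle's logarithm, every prime `p`); no definition, no named fact, no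
`sorry`.

## What this file does

The two halves of route R1 read the Heegner point through `log_{ω_E} P ∈ ℚ_p`
(`Halves.logOmega W p ι P := log_W(z(m₀ • P_ι))/m₀`, `m₀ = [E(ℚ_p) : E₁(ℚ_p)]`, shared receptacle
`X11b/HalvesReceptacle.lean`). The Additive cell has the `ℤ_p`-linear logarithm on ALL of `E(ℚ_p)`
(`Additive.LocalLog.padicLog`, `= L(N • Q)/N`, `N = [E(ℚ_p) : E⁽²⁾(ℚ_p)]`, kernel = torsion). Here:

* §1 **`R1.logOmega_eq_padicLog`** — `logOmega W p ι P = padicLog (W ⊗ ℚ_p) P_ι` (`N = p·m₀`,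
  `log_W z(p • Q) = p · log_W z(Q)` on `E₁(ℚ_p)`); hence **`R1.logOmega_eq_zero_iff`**:
  `log_{ω_E} P = 0 ↔ P` is a torsion point of `E(K)` (`P ↦ P_ι` is injective), and
  `R1.logOmega_ne_zero` for `P` of infinite order — the anti-vacuity input of the H2-shape that
  gen 20 could only DERIVE from CTL₀ ∧ H3 (`R1.valuation_constantCoeff_eq_of_span_map_eq`).
* §2 **`R1.logOmega_map_eq_or_eq_neg_of_rank_one`** — for an involution `τ` of `K` and
  `rank_ℤ E(K) = 1`, `log_{ω_E}(τ_* P) = ± log_{ω_E} P` along any `ι : K → ℚ_p` (`τ_* P = ±P + T`,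
  `T` torsion, lit-cgls's `exists_isOfFinAddOrder_sub_or_add_of_finrank_eq_one`; `log` is additive
  and kills torsion — NO parity hypothesis on `p`), so **`R1.sq_logOmega_map_eq_of_rank_one`**:
  `(log_{ω_E} τ_* P)² = (log_{ω_E} P)²`, and the Cas18 Thm. 3.2 value SHAPE
  `R1.BDPValueAtOneOnTreeAt W p ι · L a` (`L(𝟙) = u·((1 − a p⁻¹)·log_{ω_E} ·)²`) holds at `τ_* P` iff
  at `P` (**`R1.bdpValueAtOneOnTreeAt_map_iff_of_rank_one`**). Gen 21 had this only for `ord_p`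
  (`R1.padicLogOrd_map_eq_of_rank_one`, `p ≠ 2`).

Consumed by `RouteR1HalvesDegenerateFrame.lean` (the gen-21 ∀-shapes are refutable) and
`RouteR1HalvesAllFrames.lean` (the corrected ∀-shapes; H2 on all frames from print). Labels
unchanged; nothing booked.

References: [Castella2018] §2.2, Thm. 3.2 (arXiv:1704.06608 pp. 5, 9); [SilvermanAEC2009] IV.6.4,
VII.2.2, VII.6.3, VIII.6.7.
-/

noncomputable section

open scoped Classical

open WeierstrassCurve NumberField IsDedekindDomain Field PowerSeries
open Literature.NumberTheory.EllipticCurves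
open Literature.NumberTheory.EllipticCurves.Rank1Residual
open Summit.BirchSwinnertonDyer.Rank1Residual.X11b.Halves

namespace Summit.BirchSwinnertonDyer.Rank1Residual.X11b

/-! ### §1 `log_{ω_E} P` is the `p`-adic logarithm of `P_ι`; it vanishes exactly at torsion points -/

section Bridge

variable (W : WeierstrassCurve ℚ) [W.IsElliptic] [W.IsGloballyMinimal] (p : ℕ) [Fact p.Prime]
  {K : Type} [Field K] [NumberField K] (ι : K →+* ℚ_[p]) (P : (W.baseChange K).toAffine.Point)

/-- **`log_{ω_E} P = padicLog (W ⊗ ℚ_p) P_ι`**: the receptacle's `log_W(z(m₀ • P_ι))/m₀`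
(`m₀ = [E(ℚ_p) : E₁(ℚ_p)]`) is the Additive cell's `ℤ_p`-linear logarithm `L(N • P_ι)/N`
(`N = [E(ℚ_p) : E⁽²⁾(ℚ_p)] = p·m₀`, `L = log_W ∘ z` on `E⁽²⁾(ℚ_p)`, `log_W z(p • Q) = p·log_W z(Q)` on
`E₁(ℚ_p)`). [cite: SilvermanAEC2009, IV.6.4 and VII.6.3] [cite: Castella2018, §2.2 (arXiv:1704.06608 p. 5)] -/
theorem R1.logOmega_eq_padicLog :
    logOmega W p ι P = Additive.LocalLog.padicLog (W.baseChange ℚ_[p]) (padicPointOf W p ι P) := by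
  set X := W.baseChange ℚ_[p] with hX
  have hm : X.IsInReductionKernel ((X.formalFiltration 1).index • padicPointOf W p ι P) :=
    ((X.formalFiltration 1).nsmul_index_mem _).1
  have hp0 : (p : ℚ_[p]) ≠ 0 := Nat.cast_ne_zero.mpr (Fact.out : p.Prime).ne_zero
  rw [Additive.LocalLog.padicLog_eq_padicLogPoint_nsmul_div, LocalIndex.index_formalFiltration_two,
    mul_nsmul', Additive.LocalLog.padicLogPoint_nsmul X hm p, Nat.cast_mul, mul_div_mul_left _ _ hp0]
  rfl

/-- **`log_{ω_E} P = 0` iff `P ∈ E(K)` is a torsion point** (kernel of `padicLog` = torsion;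
`P ↦ P_ι` is an injective homomorphism). [cite: SilvermanAEC2009, IV.6.4 and VII.6.3] -/
theorem R1.logOmega_eq_zero_iff : logOmega W p ι P = 0 ↔ IsOfFinAddOrder P := by
  rw [R1.logOmega_eq_padicLog, Additive.LocalLog.padicLog_eq_zero_iff]
  exact (WeierstrassCurve.Affine.Point.map_injective (f := ι.toRatAlgHom)).isOfFinAddOrder_iff

variable {P} in
/-- `log_{ω_E} P ≠ 0` for `P` of infinite order. [cite: SilvermanAEC2009, IV.6.4 and VII.6.3] -/
theorem R1.logOmega_ne_zero (hP : ¬ IsOfFinAddOrder P) : logOmega W p ι P ≠ 0 :=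
  fun h ↦ hP ((R1.logOmega_eq_zero_iff W p ι P).mp h)

end Bridge

/-! ### §2 `(log_{ω_E} τ_* P)² = (log_{ω_E} P)²` in rank one; the value shape at `τ_* P` and at `P` -/

section Symmetry

variable (W : WeierstrassCurve ℚ) [W.IsElliptic] [W.IsGloballyMinimal] (p : ℕ) [Fact p.Prime]
  {K : Type} [Field K] [NumberField K] (ι : K →+* ℚ_[p]) (P : (W.baseChange K).toAffine.Point)

variable {P} in
/-- **`log_{ω_E}(τ_* P) = ± log_{ω_E} P` along any `ι : K → ℚ_p`**, for an involution `τ` of `K`,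
`rank_ℤ E(K) = 1` and `P` of infinite order: `τ_* P = ±P + T` with `T` torsion
(`exists_isOfFinAddOrder_sub_or_add_of_finrank_eq_one`, Mordell–Weil), `log` is additive and kills
torsion (§1). No hypothesis on `p`. [cite: SilvermanAEC2009, VIII.6.7 and IV.6.4] -/
theorem R1.logOmega_map_eq_or_eq_neg_of_rank_one (τ : K →+* K) (hτ : ∀ x, τ (τ x) = x)
    (hrk : (W.baseChange K).mordellWeilRank = 1) (hP : ¬ IsOfFinAddOrder P) :
    logOmega W p ι (WeierstrassCurve.Affine.Point.map τ.toRatAlgHom P) = logOmega W p ι P ∨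
      logOmega W p ι (WeierstrassCurve.Affine.Point.map τ.toRatAlgHom P) = -logOmega W p ι P := by
  haveI : (W.baseChange K).IsElliptic := by rw [baseChange]; infer_instance
  haveI : Module.Finite ℤ (W.baseChange K).toAffine.Point := (W.baseChange K).module_finite_point_holds
  set f : (W.baseChange K).toAffine.Point →+ (W.baseChange K).toAffine.Point :=
    WeierstrassCurve.Affine.Point.map τ.toRatAlgHom with hf
  have hff : ∀ Q, f (f Q) = Q := by
    rintro (_ | ⟨x, y, hxy⟩)
    · rfl
    · simp only [hf, WeierstrassCurve.Affine.Point.map_some]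
      congr 1 <;> exact hτ _
  set g : (W.baseChange K).toAffine.Point →+ (W.baseChange ℚ_[p]).toAffine.Point :=
    WeierstrassCurve.Affine.Point.map ι.toRatAlgHom with hg
  have hread : ∀ Q, logOmega W p ι Q = Additive.LocalLog.padicLog (W.baseChange ℚ_[p]) (g Q) :=
    fun Q ↦ R1.logOmega_eq_padicLog W p ι Q
  have hkill : ∀ T, IsOfFinAddOrder T →
      Additive.LocalLog.padicLog (W.baseChange ℚ_[p]) (g T) = 0 :=
    fun T hT ↦ (Additive.LocalLog.padicLog_eq_zero_iff _ _).mpr (g.isOfFinAddOrder hT)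
  rcases exists_isOfFinAddOrder_sub_or_add_of_finrank_eq_one hrk f hff P hP with hT | hT
  · left
    have hQ : f P = (f P - P) + P := by abel
    rw [hread, hread, hQ, map_add, map_add, hkill _ hT, zero_add]
  · right
    have hQ : f P = (f P + P) + (-P) := by abel
    rw [hread, hread, hQ, map_add, map_add, hkill _ hT, zero_add, map_neg, map_neg]

variable {P} in
/-- **`(log_{ω_E} τ_* P)² = (log_{ω_E} P)²`** in rank one (involution `τ`, `P` of infinite order).
[cite: SilvermanAEC2009, VIII.6.7 and IV.6.4] -/
theorem R1.sq_logOmega_map_eq_of_rank_one (τ : K →+* K) (hτ : ∀ x, τ (τ x) = x)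
    (hrk : (W.baseChange K).mordellWeilRank = 1) (hP : ¬ IsOfFinAddOrder P) :
    logOmega W p ι (WeierstrassCurve.Affine.Point.map τ.toRatAlgHom P) ^ 2 = logOmega W p ι P ^ 2 := by
  rcases R1.logOmega_map_eq_or_eq_neg_of_rank_one W p ι τ hτ hrk hP with h | h <;> rw [h]
  ring

variable {P} in
/-- **The Cas18 Thm. 3.2 value SHAPE does not see the Galois conjugate in rank one**: for an
involution `τ` of `K`, `rank_ℤ E(K) = 1`, `P` of infinite order, any `L ∈ R₀⟦T⟧` and `a ∈ ℤ`,
`R1.BDPValueAtOneOnTreeAt W p ι (τ_* P) L a ↔ R1.BDPValueAtOneOnTreeAt W p ι P L a`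
(`L(𝟙) = u·((1 − a p⁻¹)·log_{ω_E} ·)²` only involves the square of the logarithm).
[cite: Castella2018, Thm. 3.2 (arXiv:1704.06608 p. 9) (shape only; nothing asserted)] -/
theorem R1.bdpValueAtOneOnTreeAt_map_iff_of_rank_one (τ : K →+* K) (hτ : ∀ x, τ (τ x) = x)
    (hrk : (W.baseChange K).mordellWeilRank = 1) (hP : ¬ IsOfFinAddOrder P) (L : UnrSeries p)
    (a : ℤ) :
    R1.BDPValueAtOneOnTreeAt W p ι (WeierstrassCurve.Affine.Point.map τ.toRatAlgHom P) L a ↔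
      R1.BDPValueAtOneOnTreeAt W p ι P L a := by
  have h := R1.sq_logOmega_map_eq_of_rank_one W p ι τ hτ hrk hP
  have key : ∀ x : ℚ_[p],
      (algebraMap ℚ_[p] ℂ_[p] (((1 : ℚ_[p]) - (a : ℚ_[p]) * (p : ℚ_[p])⁻¹) * x)) ^ 2 =
        algebraMap ℚ_[p] ℂ_[p] ((((1 : ℚ_[p]) - (a : ℚ_[p]) * (p : ℚ_[p])⁻¹)) ^ 2 * x ^ 2) := by
    intro x
    rw [← map_pow, mul_pow]
  unfold R1.BDPValueAtOneOnTreeAt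
  simp_rw [key, h]

end Symmetry

end Summit.BirchSwinnertonDyer.Rank1Residual.X11b

end
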